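import Literature.Computability.AlgebraicComplexity.IK20HighestWeightVectors
import Mathlib.Logic.Relation
import HarnessLib

/-!
# Ikenmeyer–Kandasamy 2020, §14 and §18 typed: `(D,K)`-hypergraphs and `(D,K)`-paired
# hypergraphs (the first step of the proof of the Tableau Lifting Theorem)

Typed literature (cell `val-lit`, residual of row IK2020-B; honest framing: bookkeeping of two
printed combinatorial definitions and two printed existence statements from the PROOF of
Ikenmeyer–Kandasamy's Tableau Lifting Theorem `IK2020_thm_13_1` (`IK20HighestWeightVectors.lean`);
VP ≠ VNP is NOT proved and nothing here is progress on it).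

Source: C. Ikenmeyer, U. Kandasamy, STOC 2020 = arXiv:1911.03990 [IkenmeyerKandasamy2019],
§14 "The hypergraphs `H^{(i)}` for even `D`" (TeX L1238–1266, L1705–1725; chunk
`paper:arxiv-1911.03990` p0021.txt:L16–33 'Definition 21', p0021.txt:L34–36 'Proposition 22') and
§18 "The hypergraphs `H^{(i)}` for odd `D`" (TeX L2512–2520, L2971–2973; chunk p0027.txt:L12–23
'Definition 37', p0027.txt:L25–27 'Proposition 38'). Printed numbering (shared equation counter,
see `IK20HighestWeightVectors.lean`): Def. 14.1, Prop. 14.2, Def. 18.1 (with eq. (18.2)),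
Prop. 18.3. The ≈ 40 Claims of §§15–17, 19–21 are proof steps and are not typed.

Rendering: a hypergraph is a finite vertex type `V` with two finite families of hyperedges
(`Finset`s of vertices), the BLOCK edges and the NAME edges (Def. 14.1 (2)); "path"/"connected"
(TeX L1246–1249) is the reflexive–transitive closure of "lie in a common hyperedge"; "set
partition" (TeX L1250) is "every vertex lies in exactly one edge of the family". `K` is a natural
number (in print "Let `D, K` be integers"; Def. 14.1 (5) `|E_Name| - |E_Block| = K` is typed as
`|E_Name| = |E_Block| + K`, and both propositions assume `K ≠ 0`; in the application `K = ϱ_i ≥ 1`).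
The chosen link vertex of Def. 14.1 (6) is an explicit argument.

* Def. 14.1 ↦ `IK2020.Hypergraph`, `Hypergraph.IsDK D K link`; Def. 18.1 ↦ `Hypergraph.IsDKPaired`.
* Prop. 14.2 ↦ `IK2020_prop_14_2` (the statement as printed, a `def … : Prop`) DISCHARGED here by
  `IK2020_prop_14_2_holds`; Prop. 18.3 ↦ `IK2020_prop_18_3` DISCHARGED by `IK2020_prop_18_3_holds`.
  Both proofs follow the printed construction (`IK2020.Chain`: a chain of `b` blocks of `D`
  vertices on the grid `Fin b × Fin D`, consecutive blocks linked by size-2 name edges, the link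
  vertex `(0,0)` in a name edge of size `≥ 2` inside block `0`; `IK2020.Chain.isDK_hyper`,
  `IK2020.Chain.isDKPaired_hyper`). One deviation inside the proof of Prop. 18.3, recorded: print
  places the `n(D-2)+2` non-bridge vertices into `K+1` name edges "so that the link vertex is in
  a name edge of size at least 2" without spelling out the sizes; for odd `D` a single large name
  edge can exceed the size bound `< D`, so the surplus is split into two name edges (`big₁` in the
  first block, `big₂` in the last block), each of size `≤ D-1`. Net debt of this file: 0.
-/

namespace Literature.Computability.AlgebraicComplexity

namespace IK2020

/-- A finite hypergraph on a vertex type `V` with two kinds of hyperedges, BLOCK edges and NAME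
edges (IK Def. 14.1 (2), TeX L1255: "`H` has two different types of hyperedges: the block edges
and the name edges"). [cite: IkenmeyerKandasamy2019, Def. 14.1] -/
structure Hypergraph (V : Type*) where
  /-- the block edges `E_Block` -/
  blocks : Finset (Finset V)
  /-- the name edges `E_Name` -/
  names : Finset (Finset V)

namespace Hypergraph

variable {V : Type*} [DecidableEq V]

/-- All hyperedges `E = E_Block ∪ E_Name`. [cite: IkenmeyerKandasamy2019, Def. 14.1] -/
def edges (H : Hypergraph V) : Finset (Finset V) :=
  H.blocks ∪ H.names

/-- Two vertices lie in a common hyperedge (a path of length one, TeX L1247).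
[cite: IkenmeyerKandasamy2019, §14] -/
def Adj (H : Hypergraph V) (v w : V) : Prop :=
  ∃ e ∈ H.edges, v ∈ e ∧ w ∈ e

/-- `H` is **connected**: every pair of vertices is joined by a path `(e₁, …, e_l)`, `v ∈ e₁`,
`w ∈ e_l`, `e_i ∩ e_{i+1} ≠ ∅` (TeX L1247–1249) — the reflexive–transitive closure of `Adj`.
[cite: IkenmeyerKandasamy2019, §14] -/
def IsConnected (H : Hypergraph V) : Prop :=
  ∀ v w : V, Relation.ReflTransGen H.Adj v w

variable (H : Hypergraph V)

/-- A family of edges is a **set partition** of the vertex set (TeX L1250: "a set of pairwise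
disjoint subsets whose union is `X`"): every vertex lies in exactly one member.
[cite: IkenmeyerKandasamy2019, §14] -/
def IsPartitionBy (E : Finset (Finset V)) : Prop :=
  ∀ v : V, ∃! e, e ∈ E ∧ v ∈ e

/-- **IK Def. 14.1: `(D,K)`-hypergraph** with chosen link vertex `link` (TeX L1251–1266; chunk
p0021.txt:L16–33 'Definition 21'): "(1) `H` is connected. (2) `H` has two different types of
hyperedges: the block edges and the name edges. (3) Each block edge has size `D`, and the set of
block edges `E_Block ⊆ E` is a set partition of `V`. (4) Each name edge has size strictly less than
`D`, but at least size `1`, and the set of name edges `E_Name ⊆ E` is a set partition of `V`.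
(5) `|E_Name| - |E_Block| = K`. (6) There exists a name edge `e_Name` and a block edge `e_Block` whose
intersection contains at least 2 vertices. We choose one of these two vertices and call it the
link vertex." [cite: IkenmeyerKandasamy2019, Def. 14.1] -/
structure IsDK (D K : ℕ) (link : V) : Prop where
  /-- (1) -/
  connected : H.IsConnected
  /-- (3), sizes -/
  card_block : ∀ e ∈ H.blocks, e.card = D
  /-- (3), partition -/
  blocks_partition : IsPartitionBy H.blocks
  /-- (4), sizes -/
  card_name : ∀ e ∈ H.names, 1 ≤ e.card ∧ e.card < D
  /-- (4), partition -/
  names_partition : IsPartitionBy H.names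
  /-- (5), as `|E_Name| = |E_Block| + K` -/
  card_names : H.names.card = H.blocks.card + K
  /-- (6), with the chosen link vertex -/
  link_mem : ∃ eN ∈ H.names, ∃ eB ∈ H.blocks, link ∈ eN ∧ link ∈ eB ∧ 2 ≤ (eN ∩ eB).card

/-- **IK Def. 18.1: `(D,K)`-paired-hypergraph** (TeX L2512–2520 with eq. (18.2); chunk
p0027.txt:L12–23 'Definition 37'): "a `(D,K)`-hypergraph `H = (V,E)` that satisfies the following
additional property: Each block edge `e ∈ E_Block` is paired with another block edge `ē ∈ E_Block`
such that they are connected by a name edge, i.e., there are vertices `v ∈ e` and `v̄ ∈ ē` called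
bridge vertices and a name edge `e_Name ∈ E_Name` such that `v, v̄ ∈ e_Name`. In other words, the set
of block edges can be written as a disjoint union of sets of cardinality two such that the elements
of each of the sets are connected by a name edge." The pairing is a fixed-point-free involution
`pair` on the block edges. [cite: IkenmeyerKandasamy2019, Def. 18.1] -/
structure IsDKPaired (D K : ℕ) (link : V) : Prop extends H.IsDK D K link where
  /-- eq. (18.2) -/
  paired : ∃ pair : Finset V → Finset V, ∀ e ∈ H.blocks,
    pair e ∈ H.blocks ∧ pair e ≠ e ∧ pair (pair e) = e ∧
      ∃ v ∈ e, ∃ w ∈ pair e, ∃ eN ∈ H.names, v ∈ eN ∧ w ∈ eN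

end Hypergraph


/-! ### The chain construction of the printed proofs (Props. 14.2 and 18.3)

Vertices: the grid `Fin b × Fin D` (`b` blocks of `D` vertices, block `j` = row `j`). Name edges:
the `b - 1` BRIDGES `{(j, D-1), (j+1, 0)}` (TeX L1713: "the rightmost vertex of every block edge but
the last shall be placed in a size 2 name edge with the leftmost vertex of the next block edge"),
a name edge `big₁` = the first `L₁` vertices of block `0` (it contains the link vertex `(0,0)` and
`(0,1)`, TeX L1723–1724), a name edge `big₂` = the last `L₂` vertices of the last block, and all
other vertices as singletons; `|E_Name| - |E_Block| = b(D-2) + 3 - L₁ - L₂`. -/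

namespace Chain

variable (D b L₁ L₂ : ℕ)

/-- Block `j` = row `j` of the grid. [folklore] -/
def row (j : Fin b) : Finset (Fin b × Fin D) :=
  Finset.univ.filter fun p => p.1 = j

/-- The bridge `{(j, D-1), (j+1, 0)}` between blocks `j` and `j+1`. [folklore] -/
def bridge (j : Fin b) : Finset (Fin b × Fin D) :=
  Finset.univ.filter fun p => (p.1 = j ∧ p.2.val + 1 = D) ∨ (p.1.val = j.val + 1 ∧ p.2.val = 0)

/-- The vertices on no bridge. [folklore] -/
def inner : Finset (Fin b × Fin D) :=
  Finset.univ.filter fun p =>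
    ¬ ((p.2.val + 1 = D ∧ p.1.val + 1 < b) ∨ (p.2.val = 0 ∧ 0 < p.1.val))

/-- The name edge of the link vertex: the first `L₁` vertices of block `0`. [folklore] -/
def big₁ : Finset (Fin b × Fin D) :=
  Finset.univ.filter fun p => p.1.val = 0 ∧ p.2.val < L₁

/-- A second large name edge: the last `L₂` vertices of the last block. [folklore] -/
def big₂ : Finset (Fin b × Fin D) :=
  Finset.univ.filter fun p => p.1.val + 1 = b ∧ D ≤ p.2.val + L₂

/-- The remaining inner vertices as singleton name edges. [folklore] -/
def singles : Finset (Finset (Fin b × Fin D)) :=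
  (inner D b \ (big₁ D b L₁ ∪ big₂ D b L₂)).image fun p => {p}

/-- The block edges. [folklore] -/
def blocks : Finset (Finset (Fin b × Fin D)) :=
  Finset.univ.image (row D b)

/-- The bridges. [folklore] -/
def bridges : Finset (Finset (Fin b × Fin D)) :=
  (Finset.univ.filter fun j : Fin b => j.val + 1 < b).image (bridge D b)

/-- The name edges. [folklore] -/
def names : Finset (Finset (Fin b × Fin D)) :=
  bridges D b ∪ insert (big₁ D b L₁) (insert (big₂ D b L₂) (singles D b L₁ L₂))

/-- The chain hypergraph. [folklore] -/
def hyper : Hypergraph (Fin b × Fin D) :=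
  ⟨blocks D b, names D b L₁ L₂⟩

variable {D b L₁ L₂}

/-- Bookkeeping for the chain construction (`mem_row`). [folklore] -/
private theorem mem_row {j : Fin b} {p : Fin b × Fin D} : p ∈ row D b j ↔ p.1 = j := by
  simp [row]

/-- Bookkeeping for the chain construction (`mem_bridge`). [folklore] -/
private theorem mem_bridge {j : Fin b} {p : Fin b × Fin D} :
    p ∈ bridge D b j ↔ (p.1 = j ∧ p.2.val + 1 = D) ∨ (p.1.val = j.val + 1 ∧ p.2.val = 0) := by
  simp only [bridge, Finset.mem_filter, Finset.mem_univ, true_and]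

/-- Bookkeeping for the chain construction (`mem_inner`). [folklore] -/
private theorem mem_inner {p : Fin b × Fin D} :
    p ∈ inner D b ↔ ¬ ((p.2.val + 1 = D ∧ p.1.val + 1 < b) ∨ (p.2.val = 0 ∧ 0 < p.1.val)) := by
  simp only [inner, Finset.mem_filter, Finset.mem_univ, true_and]

/-- Bookkeeping for the chain construction (`mem_big₁`). [folklore] -/
private theorem mem_big₁ {p : Fin b × Fin D} : p ∈ big₁ D b L₁ ↔ p.1.val = 0 ∧ p.2.val < L₁ := by
  simp only [big₁, Finset.mem_filter, Finset.mem_univ, true_and]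

/-- Bookkeeping for the chain construction (`mem_big₂`). [folklore] -/
private theorem mem_big₂ {p : Fin b × Fin D} :
    p ∈ big₂ D b L₂ ↔ p.1.val + 1 = b ∧ D ≤ p.2.val + L₂ := by
  simp only [big₂, Finset.mem_filter, Finset.mem_univ, true_and]

/-- Bookkeeping for the chain construction (`mem_blocks`). [folklore] -/
private theorem mem_blocks {E : Finset (Fin b × Fin D)} : E ∈ blocks D b ↔ ∃ j, row D b j = E := by
  simp [blocks]

/-- Bookkeeping for the chain construction (`mem_singles`). [folklore] -/
private theorem mem_singles {E : Finset (Fin b × Fin D)} :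
    E ∈ singles D b L₁ L₂ ↔
      ∃ p, (p ∈ inner D b ∧ p ∉ big₁ D b L₁ ∧ p ∉ big₂ D b L₂) ∧ {p} = E := by
  simp only [singles, Finset.mem_image, Finset.mem_sdiff, Finset.mem_union, not_or, and_assoc]

/-- Bookkeeping for the chain construction (`bridge_mem_names`). [folklore] -/
private theorem bridge_mem_names {j : Fin b} (hj : j.val + 1 < b) :
    bridge D b j ∈ names D b L₁ L₂ :=
  Finset.mem_union_left _ (Finset.mem_image.mpr ⟨j, by simpa using hj, rfl⟩)

/-- Bookkeeping for the chain construction (`big₁_mem_names`). [folklore] -/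
private theorem big₁_mem_names : big₁ D b L₁ ∈ names D b L₁ L₂ :=
  Finset.mem_union_right _ (Finset.mem_insert_self _ _)

/-- Bookkeeping for the chain construction (`big₂_mem_names`). [folklore] -/
private theorem big₂_mem_names : big₂ D b L₂ ∈ names D b L₁ L₂ :=
  Finset.mem_union_right _ (Finset.mem_insert_of_mem (Finset.mem_insert_self _ _))

/-- Bookkeeping for the chain construction (`singleton_mem_names`). [folklore] -/
private theorem singleton_mem_names {p : Fin b × Fin D} (h1 : p ∈ inner D b) (h2 : p ∉ big₁ D b L₁)
    (h3 : p ∉ big₂ D b L₂) : ({p} : Finset (Fin b × Fin D)) ∈ names D b L₁ L₂ :=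
  Finset.mem_union_right _ (Finset.mem_insert_of_mem (Finset.mem_insert_of_mem
    (mem_singles.mpr ⟨p, ⟨h1, h2, h3⟩, rfl⟩)))

/-- Bookkeeping for the chain construction (`names_cases`). [folklore] -/
private theorem names_cases {E : Finset (Fin b × Fin D)} (hE : E ∈ names D b L₁ L₂) :
    (∃ j : Fin b, j.val + 1 < b ∧ bridge D b j = E) ∨ E = big₁ D b L₁ ∨ E = big₂ D b L₂ ∨
      ∃ p, (p ∈ inner D b ∧ p ∉ big₁ D b L₁ ∧ p ∉ big₂ D b L₂) ∧ {p} = E := by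
  rcases Finset.mem_union.mp hE with h | h
  · left
    obtain ⟨j, hj, rfl⟩ := Finset.mem_image.mp h
    exact ⟨j, by simpa using hj, rfl⟩
  · right
    rcases Finset.mem_insert.mp h with h | h
    · exact Or.inl h
    rcases Finset.mem_insert.mp h with h | h
    · exact Or.inr (Or.inl h)
    · exact Or.inr (Or.inr (mem_singles.mp h))

/-! #### Blocks -/

/-- Bookkeeping for the chain construction (`card_row`). [folklore] -/
private theorem card_row (j : Fin b) : (row D b j).card = D := by
  have h : row D b j = (Finset.univ : Finset (Fin D)).image fun c => (j, c) := by
    ext p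
    simp only [mem_row, Finset.mem_image, Finset.mem_univ, true_and]
    constructor
    · intro h
      exact ⟨p.2, Prod.ext h.symm rfl⟩
    · rintro ⟨c, rfl⟩
      rfl
  rw [h, Finset.card_image_of_injective _ fun c c' hc => (Prod.mk_inj.mp hc).2]
  simp

/-- Bookkeeping for the chain construction (`row_injective`). [folklore] -/
private theorem row_injective (hD : 1 ≤ D) : Function.Injective (row D b) := by
  intro j j' h
  have hm : (j, (⟨0, hD⟩ : Fin D)) ∈ row D b j' := by rw [← h]; exact mem_row.mpr rfl
  exact mem_row.mp hm

/-- Bookkeeping for the chain construction (`card_blocks`). [folklore] -/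
private theorem card_blocks (hD : 1 ≤ D) : (blocks D b).card = b := by
  rw [blocks, Finset.card_image_of_injective _ (row_injective hD)]
  simp

/-- Bookkeeping for the chain construction (`blocks_partition`). [folklore] -/
private theorem blocks_partition : Hypergraph.IsPartitionBy (blocks D b) := by
  intro p
  refine ⟨row D b p.1, ⟨mem_blocks.mpr ⟨p.1, rfl⟩, mem_row.mpr rfl⟩, ?_⟩
  rintro E ⟨hE, hpE⟩
  obtain ⟨j, rfl⟩ := mem_blocks.mp hE
  rw [mem_row.mp hpE]

/-! #### Connectivity -/

/-- Bookkeeping for the chain construction (`reflTransGen_reverse`). [folklore] -/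
private theorem reflTransGen_reverse {α : Type*} {r : α → α → Prop}
    (hr : ∀ x y, r x y → r y x) {a c : α} (h : Relation.ReflTransGen r a c) :
    Relation.ReflTransGen r c a := by
  induction h with
  | refl => exact Relation.ReflTransGen.refl
  | tail _ hbc ih => exact Relation.ReflTransGen.head (hr _ _ hbc) ih

/-- Bookkeeping for the chain construction (`adj_symm`). [folklore] -/
private theorem adj_symm {p q : Fin b × Fin D} (h : (hyper D b L₁ L₂).Adj p q) :
    (hyper D b L₁ L₂).Adj q p := by
  obtain ⟨e, he, hp, hq⟩ := h
  exact ⟨e, he, hq, hp⟩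

/-- Bookkeeping for the chain construction (`adj_of_fst_eq`). [folklore] -/
private theorem adj_of_fst_eq {p q : Fin b × Fin D} (h : p.1 = q.1) : (hyper D b L₁ L₂).Adj p q :=
  ⟨row D b p.1, Finset.mem_union_left _ (mem_blocks.mpr ⟨p.1, rfl⟩), mem_row.mpr rfl,
    mem_row.mpr h.symm⟩

/-- Bookkeeping for the chain construction (`adj_bridge`). [folklore] -/
private theorem adj_bridge (hD : 1 ≤ D) (j : Fin b) (hj : j.val + 1 < b) :
    (hyper D b L₁ L₂).Adj (j, ⟨D - 1, by omega⟩) (⟨j.val + 1, hj⟩, ⟨0, hD⟩) :=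
  ⟨bridge D b j, Finset.mem_union_right _ (bridge_mem_names hj),
    mem_bridge.mpr (Or.inl ⟨rfl, by simp only; omega⟩), mem_bridge.mpr (Or.inr ⟨rfl, rfl⟩)⟩

/-- Bookkeeping for the chain construction (`reach_origin`). [folklore] -/
private theorem reach_origin (hb : 1 ≤ b) (hD : 1 ≤ D) :
    ∀ (n : ℕ) (p : Fin b × Fin D), p.1.val = n →
      Relation.ReflTransGen (hyper D b L₁ L₂).Adj p (⟨0, hb⟩, ⟨0, hD⟩)
  | 0, p, hp => Relation.ReflTransGen.single (adj_of_fst_eq (Fin.ext hp))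
  | n + 1, p, hp => by
    have hn : n + 1 < b := hp ▸ p.1.isLt
    set j : Fin b := ⟨n, by omega⟩
    have h1 : (hyper D b L₁ L₂).Adj p (⟨j.val + 1, hn⟩, ⟨0, hD⟩) :=
      adj_of_fst_eq (Fin.ext (by simp [j, hp]))
    have h2 : (hyper D b L₁ L₂).Adj (⟨j.val + 1, hn⟩, ⟨0, hD⟩) (j, ⟨D - 1, by omega⟩) :=
      adj_symm (adj_bridge hD j hn)
    exact Relation.ReflTransGen.head h1
      (Relation.ReflTransGen.head h2 (reach_origin hb hD n _ rfl))

/-- Bookkeeping for the chain construction (`isConnected`). [folklore] -/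
private theorem isConnected (hb : 1 ≤ b) (hD : 1 ≤ D) : (hyper D b L₁ L₂).IsConnected := by
  intro v w
  exact (reach_origin hb hD _ v rfl).trans
    (reflTransGen_reverse (fun _ _ h => adj_symm h) (reach_origin hb hD _ w rfl))

/-! #### Name edges: sizes -/

/-- Bookkeeping for the chain construction (`card_name`). [folklore] -/
private theorem card_name (hb : 1 ≤ b) (hD : 3 ≤ D) (hL₁ : 1 ≤ L₁) (hL₁D : L₁ + 1 ≤ D)
    (hL₂ : 1 ≤ L₂) (hL₂D : L₂ + 1 ≤ D) {E : Finset (Fin b × Fin D)} (hE : E ∈ names D b L₁ L₂) :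
    1 ≤ E.card ∧ E.card < D := by
  rcases names_cases hE with ⟨j, hj, rfl⟩ | rfl | rfl | ⟨p, -, rfl⟩
  · -- a bridge has exactly the two vertices `(j, D-1)`, `(j+1, 0)`
    have hsub : bridge D b j ⊆ {(j, (⟨D - 1, by omega⟩ : Fin D)), (⟨j.val + 1, hj⟩, ⟨0, by omega⟩)} := by
      intro p hp
      rcases mem_bridge.mp hp with ⟨h1, h2⟩ | ⟨h1, h2⟩
      · exact Finset.mem_insert.mpr (Or.inl (Prod.ext h1 (Fin.ext (by simp only; omega))))
      · exact Finset.mem_insert_of_mem (Finset.mem_singleton.mpr (Prod.ext (Fin.ext h1) (Fin.ext h2)))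
    refine ⟨Finset.card_pos.mpr ⟨(j, ⟨D - 1, by omega⟩), mem_bridge.mpr (Or.inl ⟨rfl, by
      simp only; omega⟩)⟩, ?_⟩
    exact (Finset.card_le_card hsub).trans_lt ((Finset.card_le_two).trans_lt (by omega))
  · have hsub : big₁ D b L₁ ⊆ row D b ⟨0, hb⟩ := fun p hp =>
      mem_row.mpr (Fin.ext (mem_big₁.mp hp).1)
    have hne : ¬ row D b ⟨0, hb⟩ ⊆ big₁ D b L₁ := fun h => by
      have := (mem_big₁.mp (h (mem_row.mpr (rfl : ((⟨0, hb⟩ : Fin b), (⟨D - 1, by omega⟩ : Fin D)).1 = _)))).2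
      simp only at this
      omega
    refine ⟨Finset.card_pos.mpr ⟨(⟨0, hb⟩, ⟨0, by omega⟩), mem_big₁.mpr ⟨rfl, by simp only; omega⟩⟩, ?_⟩
    calc (big₁ D b L₁).card < (row D b ⟨0, hb⟩).card := Finset.card_lt_card ⟨hsub, hne⟩
      _ = D := card_row _
  · have hsub : big₂ D b L₂ ⊆ row D b ⟨b - 1, by omega⟩ := fun p hp =>
      mem_row.mpr (Fin.ext (by have := (mem_big₂.mp hp).1; simp only; omega))
    have hne : ¬ row D b ⟨b - 1, by omega⟩ ⊆ big₂ D b L₂ := fun h => by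
      have := (mem_big₂.mp (h (mem_row.mpr (rfl : ((⟨b - 1, by omega⟩ : Fin b), (⟨0, by omega⟩ : Fin D)).1 = _)))).2
      simp only at this
      omega
    refine ⟨Finset.card_pos.mpr ⟨(⟨b - 1, by omega⟩, ⟨D - 1, by omega⟩), mem_big₂.mpr ⟨by simp only; omega, by simp only; omega⟩⟩, ?_⟩
    calc (big₂ D b L₂).card < (row D b ⟨b - 1, by omega⟩).card := Finset.card_lt_card ⟨hsub, hne⟩
      _ = D := card_row _
  · simp only [Finset.card_singleton]
    omega

/-! #### Name edges: the partition -/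

/-- The name edge of a vertex. [folklore] -/
private def nameOf (p : Fin b × Fin D) : Finset (Fin b × Fin D) :=
  if p.2.val + 1 = D ∧ p.1.val + 1 < b then bridge D b p.1
  else if h : p.2.val = 0 ∧ 0 < p.1.val then bridge D b ⟨p.1.val - 1, by omega⟩
  else if p ∈ big₁ D b L₁ then big₁ D b L₁
  else if p ∈ big₂ D b L₂ then big₂ D b L₂
  else {p}

/-- Bookkeeping for the chain construction (`nameOf_spec`). [folklore] -/
private theorem nameOf_spec (p : Fin b × Fin D) :
    nameOf (L₁ := L₁) (L₂ := L₂) p ∈ names D b L₁ L₂ ∧ p ∈ nameOf (L₁ := L₁) (L₂ := L₂) p := by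
  unfold nameOf
  split_ifs with h1 h2 h3 h4
  · exact ⟨bridge_mem_names h1.2, mem_bridge.mpr (Or.inl ⟨rfl, h1.1⟩)⟩
  · refine ⟨bridge_mem_names (by simp only; omega), mem_bridge.mpr (Or.inr ⟨by simp only; omega, h2.1⟩)⟩
  · exact ⟨big₁_mem_names, h3⟩
  · exact ⟨big₂_mem_names, h4⟩
  · exact ⟨singleton_mem_names (mem_inner.mpr (not_or.mpr ⟨h1, h2⟩)) h3 h4, Finset.mem_singleton_self p⟩

/-- Bookkeeping for the chain construction (`eq_nameOf`). [folklore] -/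
private theorem eq_nameOf (hD : 3 ≤ D) (hL₁D : L₁ + 1 ≤ D) (hL₂D : L₂ + 1 ≤ D)
    (hsum : b = 1 → L₁ + L₂ ≤ D) {E : Finset (Fin b × Fin D)} (hE : E ∈ names D b L₁ L₂)
    {p : Fin b × Fin D} (hp : p ∈ E) : E = nameOf (L₁ := L₁) (L₂ := L₂) p := by
  unfold nameOf
  rcases names_cases hE with ⟨j, hj, rfl⟩ | rfl | rfl | ⟨q, ⟨hq1, hq2, hq3⟩, rfl⟩
  · rcases mem_bridge.mp hp with ⟨h1, h2⟩ | ⟨h1, h2⟩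
    · have hc : p.2.val + 1 = D ∧ p.1.val + 1 < b := ⟨h2, by rw [h1]; exact hj⟩
      rw [if_pos hc, h1]
    · have hc : ¬ (p.2.val + 1 = D ∧ p.1.val + 1 < b) := fun h => by omega
      have hc' : p.2.val = 0 ∧ 0 < p.1.val := ⟨h2, by omega⟩
      rw [if_neg hc, dif_pos hc']
      congr 1
      exact Fin.ext (by simp only; omega)
  · obtain ⟨h1, h2⟩ := mem_big₁.mp hp
    have hc : ¬ (p.2.val + 1 = D ∧ p.1.val + 1 < b) := fun h => by omega
    have hc' : ¬ (p.2.val = 0 ∧ 0 < p.1.val) := fun h => by omega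
    rw [if_neg hc, dif_neg hc', if_pos hp]
  · obtain ⟨h1, h2⟩ := mem_big₂.mp hp
    have hc : ¬ (p.2.val + 1 = D ∧ p.1.val + 1 < b) := fun h => by omega
    have hc' : ¬ (p.2.val = 0 ∧ 0 < p.1.val) := fun h => by omega
    have hc'' : p ∉ big₁ D b L₁ := fun h => by
      obtain ⟨h3, h4⟩ := mem_big₁.mp h
      have := hsum (by omega)
      omega
    rw [if_neg hc, dif_neg hc', if_neg hc'', if_pos hp]
  · obtain rfl : p = q := Finset.mem_singleton.mp hp
    obtain ⟨hc, hc'⟩ := not_or.mp (mem_inner.mp hq1)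
    rw [if_neg hc, dif_neg hc', if_neg hq2, if_neg hq3]

/-- Bookkeeping for the chain construction (`names_partition`). [folklore] -/
private theorem names_partition (hD : 3 ≤ D) (hL₁D : L₁ + 1 ≤ D) (hL₂D : L₂ + 1 ≤ D)
    (hsum : b = 1 → L₁ + L₂ ≤ D) : Hypergraph.IsPartitionBy (names D b L₁ L₂) := by
  intro p
  refine ⟨nameOf p, nameOf_spec p, ?_⟩
  rintro E ⟨hE, hpE⟩
  exact eq_nameOf hD hL₁D hL₂D hsum hE hpE

/-! #### Counting the name edges -/

/-- Bookkeeping for the chain construction (`subset_inner_of_mem_insert`). [folklore] -/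
private theorem subset_inner_of_mem_insert (hL₁D : L₁ + 1 ≤ D) (hL₂D : L₂ + 1 ≤ D)
    {E : Finset (Fin b × Fin D)}
    (hE : E ∈ insert (big₁ D b L₁) (insert (big₂ D b L₂) (singles D b L₁ L₂))) : E ⊆ inner D b := by
  intro p hp
  rw [mem_inner, not_or]
  rcases Finset.mem_insert.mp hE with rfl | hE
  · obtain ⟨h1, h2⟩ := mem_big₁.mp hp
    constructor <;> intro h <;> omega
  rcases Finset.mem_insert.mp hE with rfl | hE
  · obtain ⟨h1, h2⟩ := mem_big₂.mp hp
    constructor <;> intro h <;> omega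
  · obtain ⟨q, ⟨hq1, -, -⟩, rfl⟩ := mem_singles.mp hE
    obtain rfl : p = q := Finset.mem_singleton.mp hp
    exact not_or.mp (mem_inner.mp hq1)

/-- Bookkeeping for the chain construction (`card_bridges`). [folklore] -/
private theorem card_bridges (hD : 2 ≤ D) : (bridges D b).card = b - 1 := by
  rw [bridges, Finset.card_image_of_injOn]
  · have : (Finset.univ.filter fun j : Fin b => j.val + 1 < b) =
        Finset.univ.filter fun j : Fin b => j.val < b - 1 :=
      Finset.filter_congr fun j _ => by omega
    rw [this, Fin.card_filter_val_lt]
    omega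
  · intro j hj j' _ h
    have hm : (j, (⟨D - 1, by omega⟩ : Fin D)) ∈ bridge D b j' := by
      rw [← h]; exact mem_bridge.mpr (Or.inl ⟨rfl, by simp only; omega⟩)
    rcases mem_bridge.mp hm with ⟨h1, -⟩ | ⟨-, h2⟩
    · exact h1
    · simp only at h2; omega

/-- Bookkeeping for the chain construction (`card_big₁`). [folklore] -/
private theorem card_big₁ (hb : 1 ≤ b) (hL₁D : L₁ ≤ D) : (big₁ D b L₁).card = L₁ := by
  have h : big₁ D b L₁ = (Finset.univ.filter fun c : Fin D => c.val < L₁).image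
      fun c => ((⟨0, hb⟩ : Fin b), c) := by
    ext p
    simp only [mem_big₁, Finset.mem_image, Finset.mem_filter, Finset.mem_univ, true_and]
    constructor
    · rintro ⟨h1, h2⟩
      exact ⟨p.2, h2, Prod.ext (Fin.ext h1.symm) rfl⟩
    · rintro ⟨c, hc, rfl⟩
      exact ⟨rfl, hc⟩
  rw [h, Finset.card_image_of_injective _ fun c c' hc => (Prod.mk_inj.mp hc).2,
    Fin.card_filter_val_lt]
  omega

/-- Bookkeeping for the chain construction (`card_big₂`). [folklore] -/
private theorem card_big₂ (hb : 1 ≤ b) (hL₂D : L₂ ≤ D) : (big₂ D b L₂).card = L₂ := by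
  have h : big₂ D b L₂ = (Finset.univ.filter fun c : Fin D => D ≤ c.val + L₂).image
      fun c => ((⟨b - 1, by omega⟩ : Fin b), c) := by
    ext p
    simp only [mem_big₂, Finset.mem_image, Finset.mem_filter, Finset.mem_univ, true_and]
    constructor
    · rintro ⟨h1, h2⟩
      exact ⟨p.2, h2, Prod.ext (Fin.ext (by simp only; omega)) rfl⟩
    · rintro ⟨c, hc, rfl⟩
      exact ⟨by simp only; omega, hc⟩
  rw [h, Finset.card_image_of_injective _ fun c c' hc => (Prod.mk_inj.mp hc).2]
  have h2 := Finset.card_filter_add_card_filter_not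
    (s := (Finset.univ : Finset (Fin D))) (fun c : Fin D => D ≤ c.val + L₂)
  have h3 : (Finset.univ.filter fun c : Fin D => ¬ D ≤ c.val + L₂) =
      Finset.univ.filter fun c : Fin D => c.val < D - L₂ :=
    Finset.filter_congr fun c _ => by omega
  rw [h3, Fin.card_filter_val_lt, Finset.card_univ, Fintype.card_fin] at h2
  omega

/-- Bookkeeping for the chain construction (`disjoint_big`). [folklore] -/
private theorem disjoint_big (hsum : b = 1 → L₁ + L₂ ≤ D) :
    Disjoint (big₁ D b L₁) (big₂ D b L₂) := by
  rw [Finset.disjoint_left]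
  intro p h1 h2
  obtain ⟨h1, h1'⟩ := mem_big₁.mp h1
  obtain ⟨h2, h2'⟩ := mem_big₂.mp h2
  have := hsum (by omega)
  omega

/-- Bookkeeping for the chain construction (`card_inner`). [folklore] -/
private theorem card_inner (hb : 1 ≤ b) (hD : 2 ≤ D) :
    (inner D b).card + (b - 1) + (b - 1) = b * D := by
  -- the bridge vertices: right ends `(j, D-1)`, `j+1 < b`, and left ends `(j, 0)`, `0 < j`
  have hA : (Finset.univ.filter fun p : Fin b × Fin D => p.2.val + 1 = D ∧ p.1.val + 1 < b).card =
      b - 1 := by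
    have h : (Finset.univ.filter fun p : Fin b × Fin D => p.2.val + 1 = D ∧ p.1.val + 1 < b) =
        (Finset.univ.filter fun j : Fin b => j.val < b - 1).image
          fun j => (j, (⟨D - 1, by omega⟩ : Fin D)) := by
      ext p
      simp only [Finset.mem_filter, Finset.mem_univ, true_and, Finset.mem_image]
      constructor
      · rintro ⟨h1, h2⟩
        exact ⟨p.1, by omega, Prod.ext rfl (Fin.ext (by simp only; omega))⟩
      · rintro ⟨j, hj, rfl⟩
        exact ⟨by simp only; omega, by simp only; omega⟩
    rw [h, Finset.card_image_of_injective _ fun j j' hj => (Prod.mk_inj.mp hj).1,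
      Fin.card_filter_val_lt]
    omega
  have hB : (Finset.univ.filter fun p : Fin b × Fin D => p.2.val = 0 ∧ 0 < p.1.val).card =
      b - 1 := by
    have h : (Finset.univ.filter fun p : Fin b × Fin D => p.2.val = 0 ∧ 0 < p.1.val) =
        (Finset.univ.filter fun j : Fin b => ¬ j.val < 1).image
          fun j => (j, (⟨0, by omega⟩ : Fin D)) := by
      ext p
      simp only [Finset.mem_filter, Finset.mem_univ, true_and, Finset.mem_image]
      constructor
      · rintro ⟨h1, h2⟩
        exact ⟨p.1, by omega, Prod.ext rfl (Fin.ext (by simp only; omega))⟩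
      · rintro ⟨j, hj, rfl⟩
        exact ⟨rfl, by simp only; omega⟩
    rw [h, Finset.card_image_of_injective _ fun j j' hj => (Prod.mk_inj.mp hj).1]
    have h2 := Finset.card_filter_add_card_filter_not
      (s := (Finset.univ : Finset (Fin b))) (fun j : Fin b => j.val < 1)
    rw [Fin.card_filter_val_lt, Finset.card_univ, Fintype.card_fin] at h2
    omega
  have hAB : (Finset.univ.filter fun p : Fin b × Fin D =>
      (p.2.val + 1 = D ∧ p.1.val + 1 < b) ∨ (p.2.val = 0 ∧ 0 < p.1.val)).card = (b - 1) + (b - 1) := by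
    rw [Finset.filter_or, Finset.card_union_of_disjoint, hA, hB]
    rw [Finset.disjoint_filter]
    intro p _ h1 h2
    omega
  have h := Finset.card_filter_add_card_filter_not
    (s := (Finset.univ : Finset (Fin b × Fin D)))
    (fun p : Fin b × Fin D => (p.2.val + 1 = D ∧ p.1.val + 1 < b) ∨ (p.2.val = 0 ∧ 0 < p.1.val))
  rw [hAB, Finset.card_univ, Fintype.card_prod, Fintype.card_fin, Fintype.card_fin] at h
  rw [inner]
  omega

/-- Bookkeeping for the chain construction (`card_names`). [folklore] -/
private theorem card_names (hb : 1 ≤ b) (hD : 3 ≤ D) (hL₁ : 1 ≤ L₁) (hL₁D : L₁ + 1 ≤ D)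
    (hL₂D : L₂ + 1 ≤ D) (hsum : b = 1 → L₁ + L₂ ≤ D) {K : ℕ}
    (hK : K + L₁ + L₂ = b * (D - 2) + 3) :
    (names D b L₁ L₂).card = (blocks D b).card + K := by
  -- the four families of name edges are pairwise disjoint
  have hdisj : Disjoint (bridges D b)
      (insert (big₁ D b L₁) (insert (big₂ D b L₂) (singles D b L₁ L₂))) := by
    rw [Finset.disjoint_left]
    intro E hE hE'
    obtain ⟨j, hj, rfl⟩ := Finset.mem_image.mp hE
    have hj' : j.val + 1 < b := by simpa using hj
    have hm : (j, (⟨D - 1, by omega⟩ : Fin D)) ∈ bridge D b j :=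
      mem_bridge.mpr (Or.inl ⟨rfl, by simp only; omega⟩)
    have := mem_inner.mp (subset_inner_of_mem_insert hL₁D hL₂D hE' hm)
    simp only at this
    omega
  have h01 : big₁ D b L₁ ∉ insert (big₂ D b L₂) (singles D b L₁ L₂) := by
    intro h
    rcases Finset.mem_insert.mp h with h | h
    · have hm : ((⟨0, hb⟩ : Fin b), (⟨0, by omega⟩ : Fin D)) ∈ big₁ D b L₁ :=
        mem_big₁.mpr ⟨rfl, by simp only; omega⟩
      rw [h] at hm
      have := (mem_big₂.mp hm).2
      simp only at this
      omega
    · obtain ⟨q, ⟨-, hq2, -⟩, hq⟩ := mem_singles.mp h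
      exact hq2 (hq ▸ Finset.mem_singleton_self q)
  have h02 : big₂ D b L₂ ∉ singles D b L₁ L₂ := by
    intro h
    obtain ⟨q, ⟨-, -, hq3⟩, hq⟩ := mem_singles.mp h
    exact hq3 (hq ▸ Finset.mem_singleton_self q)
  have hsingles : (singles D b L₁ L₂).card + (L₁ + L₂) = (inner D b).card := by
    have hsub : big₁ D b L₁ ∪ big₂ D b L₂ ⊆ inner D b := by
      intro p hp
      rcases Finset.mem_union.mp hp with hp | hp
      · exact subset_inner_of_mem_insert hL₁D hL₂D (Finset.mem_insert_self _ _) hp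
      · exact subset_inner_of_mem_insert hL₁D hL₂D
          (Finset.mem_insert_of_mem (Finset.mem_insert_self _ _)) hp
    have e1 := card_big₁ (D := D) hb (by omega : L₁ ≤ D)
    have e2 := card_big₂ (D := D) hb (by omega : L₂ ≤ D)
    have e3 := Finset.card_union_of_disjoint (disjoint_big (D := D) (L₁ := L₁) (L₂ := L₂) hsum)
    have e4 := Finset.card_sdiff_add_card_eq_card hsub
    rw [singles, Finset.card_image_of_injective _ Finset.singleton_injective]
    omega
  have hinner := card_inner (D := D) hb (by omega)
  rw [names, Finset.card_union_of_disjoint hdisj, card_bridges (by omega),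
    Finset.card_insert_of_notMem h01, Finset.card_insert_of_notMem h02, card_blocks (by omega)]
  obtain ⟨D', rfl⟩ : ∃ D', D = D' + 2 := ⟨D - 2, by omega⟩
  have hmul : b * (D' + 2) = b * D' + 2 * b := by ring
  rw [hmul] at hinner
  rw [Nat.add_sub_cancel] at hK
  generalize b * D' = M at hinner hK
  omega

/-! #### The link vertex -/

/-- Bookkeeping for the chain construction (`link_mem`). [folklore] -/
private theorem link_mem (hb : 1 ≤ b) (hD : 3 ≤ D) (hL₁ : 2 ≤ L₁) :
    ∃ eN ∈ names D b L₁ L₂, ∃ eB ∈ blocks D b,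
      ((⟨0, hb⟩ : Fin b), (⟨0, by omega⟩ : Fin D)) ∈ eN ∧
        ((⟨0, hb⟩ : Fin b), (⟨0, by omega⟩ : Fin D)) ∈ eB ∧ 2 ≤ (eN ∩ eB).card := by
  refine ⟨big₁ D b L₁, big₁_mem_names, row D b ⟨0, hb⟩, mem_blocks.mpr ⟨_, rfl⟩,
    mem_big₁.mpr ⟨rfl, by simp only; omega⟩, mem_row.mpr rfl, ?_⟩
  have hsub : ({((⟨0, hb⟩ : Fin b), (⟨0, by omega⟩ : Fin D)), (⟨0, hb⟩, ⟨1, by omega⟩)} :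
      Finset (Fin b × Fin D)) ⊆ big₁ D b L₁ ∩ row D b ⟨0, hb⟩ := by
    intro p hp
    rw [Finset.mem_inter, mem_big₁, mem_row]
    rcases Finset.mem_insert.mp hp with rfl | hp
    · exact ⟨⟨rfl, by simp only; omega⟩, rfl⟩
    · obtain rfl := Finset.mem_singleton.mp hp
      exact ⟨⟨rfl, by simp only; omega⟩, rfl⟩
  have hne : ((⟨0, hb⟩ : Fin b), (⟨0, by omega⟩ : Fin D)) ≠ (⟨0, hb⟩, ⟨1, by omega⟩) := by
    intro h
    have := congrArg (fun q : Fin b × Fin D => q.2.val) h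
    simp only at this
    omega
  calc 2 = ({((⟨0, hb⟩ : Fin b), (⟨0, by omega⟩ : Fin D)), (⟨0, hb⟩, ⟨1, by omega⟩)} :
      Finset (Fin b × Fin D)).card := (Finset.card_pair hne).symm
    _ ≤ _ := Finset.card_le_card hsub

/-! #### The chain hypergraph is a `(D, K)`-hypergraph -/

/-- The chain hypergraph on `b ≥ 1` blocks of size `D ≥ 3` with big name edges of sizes
`2 ≤ L₁ ≤ D-1`, `1 ≤ L₂ ≤ D-1` (`L₁ + L₂ ≤ D` if `b = 1`) is a `(D,K)`-hypergraph with link vertex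
`(0,0)` for `K = b(D-2) + 3 - L₁ - L₂` (the construction in the proofs of IK Props. 14.2 / 18.3).
[cite: IkenmeyerKandasamy2019, Prop. 14.2 (proof)] -/
theorem isDK_hyper (hb : 1 ≤ b) (hD : 3 ≤ D) (hL₁ : 2 ≤ L₁) (hL₁D : L₁ + 1 ≤ D) (hL₂ : 1 ≤ L₂)
    (hL₂D : L₂ + 1 ≤ D) (hsum : b = 1 → L₁ + L₂ ≤ D) {K : ℕ} (hK : K + L₁ + L₂ = b * (D - 2) + 3) :
    (hyper D b L₁ L₂).IsDK D K ((⟨0, hb⟩ : Fin b), (⟨0, by omega⟩ : Fin D)) where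
  connected := isConnected hb (by omega)
  card_block E hE := by
    obtain ⟨j, rfl⟩ := mem_blocks.mp hE
    exact card_row j
  blocks_partition := blocks_partition
  card_name E hE := card_name hb hD (by omega) hL₁D hL₂ hL₂D hE
  names_partition := names_partition hD hL₁D hL₂D hsum
  card_names := card_names hb hD (by omega) hL₁D hL₂D hsum hK
  link_mem := link_mem hb hD hL₁

/-! #### The pairing of consecutive blocks (odd `D`, an even number of blocks) -/

/-- The partner index: `2i ↔ 2i+1`. [folklore] -/
private def partner (j : ℕ) : ℕ := if j % 2 = 0 then j + 1 else j - 1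

/-- Bookkeeping for the chain construction (`partner_lt`). [folklore] -/
private theorem partner_lt (hbev : Even b) (j : Fin b) : partner j.val < b := by
  obtain ⟨t, ht⟩ := hbev
  have := j.isLt
  unfold partner
  split_ifs with h <;> omega

/-- Bookkeeping for the chain construction (`partner_ne`). [folklore] -/
private theorem partner_ne (j : ℕ) : partner j ≠ j := by
  unfold partner; split_ifs <;> omega

/-- Bookkeeping for the chain construction (`partner_partner`). [folklore] -/
private theorem partner_partner (j : ℕ) : partner (partner j) = j := by
  unfold partner; split_ifs with h1 h2 h3 <;> omega

/-- The block paired with a block: the row of partner index. [folklore] -/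
private def pair (E : Finset (Fin b × Fin D)) : Finset (Fin b × Fin D) :=
  Finset.univ.filter fun p => ∃ q ∈ E, p.1.val = partner q.1.val

/-- Bookkeeping for the chain construction (`pair_row`). [folklore] -/
private theorem pair_row (hD : 1 ≤ D) (hbev : Even b) (j : Fin b) :
    pair (row D b j) = row D b ⟨partner j.val, partner_lt hbev j⟩ := by
  ext p
  simp only [pair, Finset.mem_filter, Finset.mem_univ, true_and, mem_row]
  constructor
  · rintro ⟨q, hq, hpq⟩
    rw [hq] at hpq
    exact Fin.ext hpq
  · intro hp
    exact ⟨(j, ⟨0, hD⟩), rfl, by rw [hp]⟩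

/-- Bookkeeping for the chain construction (`paired`). [folklore] -/
private theorem paired (hD : 2 ≤ D) (hbev : Even b) :
    ∃ pair : Finset (Fin b × Fin D) → Finset (Fin b × Fin D), ∀ e ∈ blocks D b,
      pair e ∈ blocks D b ∧ pair e ≠ e ∧ pair (pair e) = e ∧
        ∃ v ∈ e, ∃ w ∈ pair e, ∃ eN ∈ names D b L₁ L₂, v ∈ eN ∧ w ∈ eN := by
  refine ⟨pair, fun e he => ?_⟩
  obtain ⟨j, rfl⟩ := mem_blocks.mp he
  rw [pair_row (by omega) hbev, pair_row (by omega) hbev]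
  refine ⟨mem_blocks.mpr ⟨_, rfl⟩, fun h => partner_ne j.val ?_, ?_, ?_⟩
  · exact (congrArg Fin.val (row_injective (by omega) h) :)
  · congr 1
    exact Fin.ext (partner_partner j.val)
  · obtain ⟨t, ht⟩ := hbev
    have hjb := j.isLt
    by_cases hj : j.val % 2 = 0
    · have hj1 : j.val + 1 < b := by omega
      have hpj : partner j.val = j.val + 1 := by unfold partner; rw [if_pos hj]
      refine ⟨(j, ⟨D - 1, by omega⟩), mem_row.mpr rfl, (⟨j.val + 1, hj1⟩, ⟨0, by omega⟩),
        mem_row.mpr (Fin.ext (by simp only; exact hpj.symm)), bridge D b j, bridge_mem_names hj1,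
        mem_bridge.mpr (Or.inl ⟨rfl, by simp only; omega⟩), mem_bridge.mpr (Or.inr ⟨rfl, rfl⟩)⟩
    · have hj1 : 1 ≤ j.val := by omega
      have hpj : partner j.val = j.val - 1 := by unfold partner; rw [if_neg hj]
      set i : Fin b := ⟨j.val - 1, by omega⟩
      have hi : i.val + 1 < b := by simp only [i]; omega
      refine ⟨(j, ⟨0, by omega⟩), mem_row.mpr rfl, (i, ⟨D - 1, by omega⟩),
        mem_row.mpr (Fin.ext (by simp only [i]; exact hpj.symm)), bridge D b i, bridge_mem_names hi,
        mem_bridge.mpr (Or.inr ⟨by simp only [i]; omega, rfl⟩),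
        mem_bridge.mpr (Or.inl ⟨rfl, by simp only; omega⟩)⟩

/-- For an even number `b` of blocks the chain hypergraph is moreover `(D,K)`-PAIRED, consecutive
blocks `2i, 2i+1` being joined through their bridge (the construction in the proof of IK
Prop. 18.3). [cite: IkenmeyerKandasamy2019, Prop. 18.3 (proof)] -/
theorem isDKPaired_hyper (hb : 1 ≤ b) (hbev : Even b) (hD : 3 ≤ D) (hL₁ : 2 ≤ L₁)
    (hL₁D : L₁ + 1 ≤ D) (hL₂ : 1 ≤ L₂) (hL₂D : L₂ + 1 ≤ D) (hsum : b = 1 → L₁ + L₂ ≤ D) {K : ℕ}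
    (hK : K + L₁ + L₂ = b * (D - 2) + 3) :
    (hyper D b L₁ L₂).IsDKPaired D K ((⟨0, hb⟩ : Fin b), (⟨0, by omega⟩ : Fin D)) where
  toIsDK := isDK_hyper hb hD hL₁ hL₁D hL₂ hL₂D hsum hK
  paired := paired (by omega) hbev

/-- `⌈K/c⌉ · c` lies between `K` and `K + c - 1`. [folklore] -/
private theorem ceilDiv_mul_bounds (K c : ℕ) (hc : 1 ≤ c) :
    K ≤ ceilDiv K c * c ∧ ceilDiv K c * c ≤ K + (c - 1) := by
  unfold ceilDiv
  exact ⟨by have := Nat.lt_div_mul_add (a := K + (c - 1)) (b := c) (by omega); omega,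
    Nat.div_mul_le_self _ _⟩

end Chain

end IK2020

open IK2020

/-- NAMED FACT (**Ikenmeyer–Kandasamy 2020, Prop. 14.2**, TeX L1705–1707; chunk p0021.txt:L34–36
'Proposition 22'): "For even `D ≥ 4`, `K ≠ 0`, there exists a `(D,K)`-hypergraph that has exactly
`⌈K/(D-2)⌉` many block edges." (`IK2020.ceilDiv K (D-2)`.) Printed proof (TeX L1708–1725): `n`
blocks in a row, the rightmost vertex of each block joined to the leftmost vertex of the next by
a size-2 name edge, the remaining `n(D-2)+2` vertices placed in `K+1` name edges with the link
vertex in a name edge of size `≥ 2` inside its block. Quantified over a finite vertex type `V`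
("there exists a hypergraph"). DISCHARGED below (`IK2020_prop_14_2_holds`).
[cite: IkenmeyerKandasamy2019, Prop. 14.2] -/
def IK2020_prop_14_2 : Prop :=
  ∀ (D K : ℕ), Even D → 4 ≤ D → K ≠ 0 →
    ∃ (V : Type) (_ : DecidableEq V) (_ : Fintype V) (H : Hypergraph V) (v : V),
      H.IsDK D K v ∧ H.blocks.card = ceilDiv K (D - 2)

/-- NAMED FACT (**Ikenmeyer–Kandasamy 2020, Prop. 18.3**, TeX L2971–2973; chunk p0027.txt:L25–27
'Proposition 38'): "For odd `D ≥ 3`, `K ≠ 0`, there exists a `(D,K)`-paired-hypergraph that has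
exactly `2⌈K/(2(D-2))⌉` many block edges." (`2 * IK2020.ceilDiv K (2 (D-2))`.) Printed proof
(TeX L2974–2990): as for Prop. 14.2 with an even number of blocks, consecutive blocks paired through
their size-2 name edge. DISCHARGED below (`IK2020_prop_18_3_holds`).
[cite: IkenmeyerKandasamy2019, Prop. 18.3] -/
def IK2020_prop_18_3 : Prop :=
  ∀ (D K : ℕ), Odd D → 3 ≤ D → K ≠ 0 →
    ∃ (V : Type) (_ : DecidableEq V) (_ : Fintype V) (H : Hypergraph V) (v : V),
      H.IsDKPaired D K v ∧ H.blocks.card = 2 * ceilDiv K (2 * (D - 2))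


/-- **DISCHARGE of `IK2020_prop_14_2`** by the printed chain construction (`IK2020.Chain.hyper`
with `b = ⌈K/(D-2)⌉` blocks, the link vertex's name edge of size `b(D-2) + 2 - K ∈ [2, D-1]`, all
other non-bridge vertices singletons). [cite: IkenmeyerKandasamy2019, Prop. 14.2] -/
theorem IK2020_prop_14_2_holds : IK2020_prop_14_2 := by
  intro D K _ hD hK
  obtain ⟨hlo, hhi⟩ := Chain.ceilDiv_mul_bounds K (D - 2) (by omega)
  set b := ceilDiv K (D - 2)
  have hb : 1 ≤ b := Nat.pos_of_ne_zero fun h => by rw [h, zero_mul] at hlo; omega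
  have h1 : 2 ≤ b * (D - 2) + 2 - K := by generalize b * (D - 2) = M at hlo hhi ⊢; omega
  have h2 : b * (D - 2) + 2 - K + 1 ≤ D := by generalize b * (D - 2) = M at hlo hhi ⊢; omega
  have h3 : K + (b * (D - 2) + 2 - K) + 1 = b * (D - 2) + 3 := by
    generalize b * (D - 2) = M at hlo hhi ⊢; omega
  exact ⟨Fin b × Fin D, inferInstance, inferInstance, Chain.hyper D b (b * (D - 2) + 2 - K) 1,
    (⟨0, hb⟩, ⟨0, by omega⟩),
    Chain.isDK_hyper hb (by omega) h1 h2 le_rfl (by omega) (fun _ => by omega) h3,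
    Chain.card_blocks (by omega)⟩

/-- **DISCHARGE of `IK2020_prop_18_3`** by the printed chain construction with `b = 2⌈K/(2(D-2))⌉`
blocks paired consecutively (`IK2020.Chain.isDKPaired_hyper`; the `b(D-2) + 3 - K` surplus
vertices are placed in at most two name edges of size `≤ D - 1`). [cite: IkenmeyerKandasamy2019, Prop. 18.3] -/
theorem IK2020_prop_18_3_holds : IK2020_prop_18_3 := by
  intro D K _ hD hK
  obtain ⟨hlo, hhi⟩ := Chain.ceilDiv_mul_bounds K (2 * (D - 2)) (by omega)
  set t := ceilDiv K (2 * (D - 2))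
  set b := 2 * t with hb_def
  have ht : 1 ≤ t := Nat.pos_of_ne_zero fun h => by rw [h, zero_mul] at hlo; omega
  have hbt : b * (D - 2) = t * (2 * (D - 2)) := by rw [hb_def]; ring
  set L := b * (D - 2) + 2 - K with hL_def
  have hL2 : 2 ≤ L := by rw [hL_def, hbt]; generalize t * (2 * (D - 2)) = M at hlo hhi ⊢; omega
  have hLD : L ≤ 2 * D - 3 := by
    rw [hL_def, hbt]; generalize t * (2 * (D - 2)) = M at hlo hhi ⊢; omega
  have hKL : K + L + 1 = b * (D - 2) + 3 := by
    rw [hL_def, hbt]; generalize t * (2 * (D - 2)) = M at hlo hhi ⊢; omega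
  refine ⟨Fin b × Fin D, inferInstance, inferInstance,
    Chain.hyper D b (min L (D - 1)) (L + 1 - min L (D - 1)), (⟨0, by omega⟩, ⟨0, by omega⟩),
    Chain.isDKPaired_hyper (by omega) ⟨t, by omega⟩ hD ?_ ?_ ?_ ?_ (fun h => by omega) ?_,
    Chain.card_blocks (by omega)⟩
  · exact le_min hL2 (by omega)
  · exact Nat.succ_le_of_lt (lt_of_le_of_lt (min_le_right _ _) (by omega))
  · have := min_le_left L (D - 1); omega
  · rcases Nat.le_total L (D - 1) with h | h
    · rw [min_eq_left h]; omega
    · rw [min_eq_right h]; omega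
  · rcases Nat.le_total L (D - 1) with h | h
    · rw [min_eq_left h]; omega
    · rw [min_eq_right h]; omega

end Literature.Computability.AlgebraicComplexity
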